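import Mathlib
import HarnessLib
import Summits.KontsevichZagierPeriods.KontsevichZagierPeriods.Theses.Neg
import Literature.NumberTheory.Transcendental.KZProductIdeal
import Literature.NumberTheory.Transcendental.KZLogCalculusProofs
import Literature.NumberTheory.Transcendental.KZCubeProducts

/-!
# Crux CancellationGap (stmt-KontsevichZagierPeriods-11011) — LINE das-square-root-seam (registered skeleton)

Skeleton line = the crux-strategist decomposition; the two stubs ARE the split children of the route item
(`stub_dasSquareAccessible` = Neg.DasSquareAccessible, `stub_dasRootNotAccessible` = Neg.DasRootNotAccessible, verbatim),
and `CancellationGap_of` is the kernel-checked composition (crux-strategist decomposition of the deciding crux stmt-KontsevichZagierPeriods-11011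
`CancellationGap` of route Neg; BC2 redirect). Two pinned statements about ONE explicit pair of
three-dimensional cube representations,

* `r₀ = [(0,1)³, t₀^{1/12-1}(1-t₀)^{1/3-1} · t₁^{5/12-1}(1-t₁)^{3/4-1} · t₂^{7/6-1}(1-t₂)^{5/6-1}]`, value
  `B(1/12,1/3)·B(5/12,3/4)·B(7/6,5/6) = Γ(1/12)Γ(1/3)Γ(3/4)Γ(5/6)` (the Γ-chain telescopes, `Γ(2) = 1`);
* `r₀' = [(0,1)³, α · (t₀(1-t₀))^{-1/2} (t₁(1-t₁))^{-1/2}]`, `α = 2^{19/12}·3^{-1/8}·(1+√3)^{1/2}`, value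
  `α·B(½,½)²·B(1,1) = α π²`,

imply `CancellationGap`:

* `DasSquareAccessible` (positive): the SQUARED identity is reachable by the four moves,
  `r.prod r ∼ r'.prod r'` for all representations pinned as `r₀`, `r₀'`;
* `DasRootNotAccessible` (negative): the identity itself is not, `¬ (r ∼ r')`.

Why this pair (planner's computation, recorded on the item): `a = (1,4,9,10)/12` is a positive
element of the Koblitz–Ogus lattice (⟨ua⟩ = 2 for every unit u mod 12, so `Γ(1/12)Γ(1/3)Γ(3/4)Γ(5/6) ∈ ℚ̄·π²`
by Deligne, *Hodge cycles on abelian varieties*, I Thm 7.15/7.18) at the SMALLEST level where one exists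
that is NOT in the lattice of standard relations (reflection + Gauss multiplication + translation; checked
at levels 12, 24, 36, 48, 60), while `2a` is: the index of the standard lattice in the Koblitz–Ogus lattice
is 1 for N ≤ 11 and 2 at N = 12 (Das's "double covering", Deligne loc. cit. Rem. 7.16 and note 22; P. Das,
Trans. AMS 352 (2000)). Concretely the square has the division-free standard
derivation {1,1,4,4,9,9,10,10} → (Legendre at 1/3) → (Gauss triplication at 1/4, backwards) → (reflection
at 1/12, 1/4) → (Legendre at 1/12) → (reflection at 1/6) → {6}⁸ = π⁴, scalars multiplying to
`α² = 2^{19/6}·3^{-1/4}·(1+√3)`, whereas `a` itself has none: over ℝ one concludes by taking the POSITIVE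
square root — an order argument the calculus of moves does not have.

The glue `cancellationGap_of_das` is the ring-theoretic heart of the crux: with `s := [(0,1)³, f + f']`
(one integrand-additivity move: `[s] ≡ [r] + [r']`), `[r×s] − [r'×s] ≡ [r]([r]+[r']) − [r']([r]+[r']) =
([r]² − [r']²) + ([r][r'] − [r'][r])` modulo the two-sided ideal `relations` (`KZ.mul_mem_relations_left_holds`,
`KZ.mul_sub_mul_comm_mem_relations`), so `r×s ∼ r'×s` follows from `r×r ∼ r'×r'`; and `s.value > 0`
because both pinned integrands are positive on the open cube (a set of positive Lebesgue measure), so the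
calculus "proves the identity after multiplying by the non-zero period ∫(f+f') but cannot cancel it".

Sources: P. Deligne (notes by J. Milne), *Hodge cycles on abelian varieties*, LNM 900 (1982), I §7;
P. Das, *Algebraic Gamma monomials and double coverings of cyclotomic fields*, Trans. AMS 352 (2000) 3557–3594;
N. Koblitz, A. Ogus, appendix to Deligne, *Valeurs de fonctions L*, PSPM 33 (1979); M. Kontsevich, D. Zagier,
*Periods* (2001), §1.2, §4.1. Deliberately NOT here: any claim about the two pinned statements themselves
(they are the new leaves of the route), and the value identity `Γ(1/12)Γ(1/3)Γ(3/4)Γ(5/6) = απ²` (not needed: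
`closes` cancels `s.value` in ℝ).
-/

noncomputable section

namespace Summit.KontsevichZagierPeriods.KontsevichZagierPeriods.Cruxes.CancellationGap.DasSquareRootSeam

open MeasureTheory Set
open Literature.NumberTheory.Transcendental Literature.NumberTheory.Transcendental.KZ

/-- The open unit cube of `ℝ³` (coordinate spelling of the route items) is open. [folklore] -/
theorem isOpen_dasCube : IsOpen {t : Fin 3 → ℝ | ∀ j, t j ∈ Set.Ioo (0:ℝ) 1} := by
  rw [KZ.setOf_forall_apply_mem_Ioo_eq_pi]
  exact isOpen_set_pi finite_univ fun _ _ => isOpen_Ioo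

/-- The open unit cube of `ℝ³` has positive Lebesgue measure. [folklore] -/
theorem volume_dasCube_pos : 0 < volume {t : Fin 3 → ℝ | ∀ j, t j ∈ Set.Ioo (0:ℝ) 1} :=
  isOpen_dasCube.measure_pos volume ⟨fun _ => 1/2, fun _ => ⟨by norm_num, by norm_num⟩⟩

/-- The Das cube-Beta integrand `∏_j t_j^{x_j-1}(1-t_j)^{y_j-1}`, `x = (1/12,5/12,7/6)`, `y = (1/3,3/4,5/6)`,
is positive on the open cube. [folklore] -/
theorem dasIntegrand_pos (t : Fin 3 → ℝ) (ht : ∀ j, t j ∈ Set.Ioo (0:ℝ) 1) :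
    0 < ∏ j, t j ^ (((![(1:ℚ)/12, 5/12, 7/6] : Fin 3 → ℚ) j : ℝ) - 1) *
      (1 - t j) ^ (((![(1:ℚ)/3, 3/4, 5/6] : Fin 3 → ℚ) j : ℝ) - 1) :=
  Finset.prod_pos fun j _ =>
    mul_pos (Real.rpow_pos_of_pos (ht j).1 _) (Real.rpow_pos_of_pos (sub_pos.2 (ht j).2) _)

/-- The comparison integrand `α · ∏_j t_j^{x_j-1}(1-t_j)^{x_j-1}`, `x = (1/2,1/2,1)`,
`α = 2^{19/12} 3^{-1/8} (1+√3)^{1/2}`, is positive on the open cube. [folklore] -/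
theorem dasPiIntegrand_pos (t : Fin 3 → ℝ) (ht : ∀ j, t j ∈ Set.Ioo (0:ℝ) 1) :
    0 < (2:ℝ) ^ ((19:ℝ)/12) * (3:ℝ) ^ (-(1:ℝ)/8) * Real.sqrt (1 + Real.sqrt 3) *
      ∏ j, t j ^ (((![(1:ℚ)/2, 1/2, 1] : Fin 3 → ℚ) j : ℝ) - 1) *
        (1 - t j) ^ (((![(1:ℚ)/2, 1/2, 1] : Fin 3 → ℚ) j : ℝ) - 1) := by
  refine mul_pos (by positivity) (Finset.prod_pos fun j _ => ?_)
  exact mul_pos (Real.rpow_pos_of_pos (ht j).1 _) (Real.rpow_pos_of_pos (sub_pos.2 (ht j).2) _)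

/-- STUB (= split child `Neg.DasSquareAccessible`, verbatim): the squared level-12 Deligne–Koblitz–Ogus identity
is reachable by the four moves for the pinned pair. [folklore] -/
theorem stub_dasSquareAccessible : ∀ (r r' : Literature.NumberTheory.Transcendental.KZ.IntegralRep 3), r.domain = {t | ∀ j, t j ∈ Set.Ioo (0:ℝ) 1} → Set.EqOn r.integrand (fun t => ∏ j, t j ^ (((![(1:ℚ)/12, 5/12, 7/6] : Fin 3 → ℚ) j : ℝ) - 1) * (1 - t j) ^ (((![(1:ℚ)/3, 3/4, 5/6] : Fin 3 → ℚ) j : ℝ) - 1)) r.domain → r'.domain = {t | ∀ j, t j ∈ Set.Ioo (0:ℝ) 1} → Set.EqOn r'.integrand (fun t => (2:ℝ) ^ ((19:ℝ)/12) * (3:ℝ) ^ (-(1:ℝ)/8) * Real.sqrt (1 + Real.sqrt 3) * ∏ j, t j ^ (((![(1:ℚ)/2, 1/2, 1] : Fin 3 → ℚ) j : ℝ) - 1) * (1 - t j) ^ (((![(1:ℚ)/2, 1/2, 1] : Fin 3 → ℚ) j : ℝ) - 1)) r'.domain → Literature.NumberTheory.Transcendental.KZ.Equivalent (r.prod r)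 (r'.prod r') := by
  sorry

/-- STUB (= split child `Neg.DasRootNotAccessible`, verbatim): the identity itself is not reachable. [folklore] -/
theorem stub_dasRootNotAccessible : ¬ (∀ (r r' : Literature.NumberTheory.Transcendental.KZ.IntegralRep 3), r.domain = {t | ∀ j, t j ∈ Set.Ioo (0:ℝ) 1} → Set.EqOn r.integrand (fun t => ∏ j, t j ^ (((![(1:ℚ)/12, 5/12, 7/6] : Fin 3 → ℚ) j : ℝ) - 1) * (1 - t j) ^ (((![(1:ℚ)/3, 3/4, 5/6] : Fin 3 → ℚ) j : ℝ) - 1)) r.domain → r'.domain = {t | ∀ j, t j ∈ Set.Ioo (0:ℝ) 1} → Set.EqOn r'.integrand (fun t => (2:ℝ) ^ ((19:ℝ)/12) * (3:ℝ) ^ (-(1:ℝ)/8) * Real.sqrt (1 + Real.sqrt 3) * ∏ j, t j ^ (((![(1:ℚ)/2, 1/2, 1] : Fin 3 → ℚ) j : ℝ) - 1) * (1 - t j) ^ (((![(1:ℚ)/2, 1/2, 1] : Fin 3 → ℚ) j : ℝ) - 1)) r'.domain → Literature.NumberTheory.Transcendental.KZ.Equivalent r r') := by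
  sorry

/-- **The cancellation gap from the square-root seam** (glue of the crux-strategist split of
`Neg.CancellationGap`, stmt-KontsevichZagierPeriods-11011): if the squared Das identity is reachable by the
moves for the pinned pair (`DasSquareAccessible`) while the identity itself is not (`DasRootNotAccessible`),
then `CancellationGap` holds with `n = m = k = 3`, the non-equivalent pinned pair `r, r'`, the auxiliary
representation `s = [(0,1)³, f + f']` of positive value, and the hand-written products `r.prod s`,
`r'.prod s`: modulo the ideal `relations`, `[r.prod s] − [r'.prod s] = [r]([s]−[r]−[r']) − [r']([s]−[r]−[r'])
+ ([r]² − [r']²) + ([r][r'] − [r'][r])`, each summand a relation. [folklore] -/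
theorem cancellationGap_of_das
    (h₁ : ∀ (r r' : Literature.NumberTheory.Transcendental.KZ.IntegralRep 3),
      r.domain = {t | ∀ j, t j ∈ Set.Ioo (0:ℝ) 1} →
      Set.EqOn r.integrand (fun t => ∏ j, t j ^ (((![(1:ℚ)/12, 5/12, 7/6] : Fin 3 → ℚ) j : ℝ) - 1) *
        (1 - t j) ^ (((![(1:ℚ)/3, 3/4, 5/6] : Fin 3 → ℚ) j : ℝ) - 1)) r.domain →
      r'.domain = {t | ∀ j, t j ∈ Set.Ioo (0:ℝ) 1} →
      Set.EqOn r'.integrand (fun t => (2:ℝ) ^ ((19:ℝ)/12) * (3:ℝ) ^ (-(1:ℝ)/8) * Real.sqrt (1 + Real.sqrt 3) *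
        ∏ j, t j ^ (((![(1:ℚ)/2, 1/2, 1] : Fin 3 → ℚ) j : ℝ) - 1) *
          (1 - t j) ^ (((![(1:ℚ)/2, 1/2, 1] : Fin 3 → ℚ) j : ℝ) - 1)) r'.domain →
      Literature.NumberTheory.Transcendental.KZ.Equivalent (r.prod r) (r'.prod r'))
    (h₂ : ¬ (∀ (r r' : Literature.NumberTheory.Transcendental.KZ.IntegralRep 3),
      r.domain = {t | ∀ j, t j ∈ Set.Ioo (0:ℝ) 1} →
      Set.EqOn r.integrand (fun t => ∏ j, t j ^ (((![(1:ℚ)/12, 5/12, 7/6] : Fin 3 → ℚ) j : ℝ) - 1) *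
        (1 - t j) ^ (((![(1:ℚ)/3, 3/4, 5/6] : Fin 3 → ℚ) j : ℝ) - 1)) r.domain →
      r'.domain = {t | ∀ j, t j ∈ Set.Ioo (0:ℝ) 1} →
      Set.EqOn r'.integrand (fun t => (2:ℝ) ^ ((19:ℝ)/12) * (3:ℝ) ^ (-(1:ℝ)/8) * Real.sqrt (1 + Real.sqrt 3) *
        ∏ j, t j ^ (((![(1:ℚ)/2, 1/2, 1] : Fin 3 → ℚ) j : ℝ) - 1) *
          (1 - t j) ^ (((![(1:ℚ)/2, 1/2, 1] : Fin 3 → ℚ) j : ℝ) - 1)) r'.domain →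
      Literature.NumberTheory.Transcendental.KZ.Equivalent r r')) :
    Summit.KontsevichZagierPeriods.KontsevichZagierPeriods.Theses.Neg.CancellationGap := by
  classical
  push Not at h₂
  obtain ⟨r, r', hrd, hri, hr'd, hr'i, hne⟩ := h₂
  -- the squared identity IS reachable for this pinned pair
  have hsq : Equivalent (r.prod r) (r'.prod r') := h₁ r r' hrd hri hr'd hr'i
  have hdd : r'.domain = r.domain := hr'd.trans hrd.symm
  -- the auxiliary representation `s = [(0,1)³, f + f']`
  have hsa' : IsSemialgebraicFunOn ℚ r.domain r'.integrand := by
    rw [← hdd]; exact r'.isSemialgebraicFunOn_integrand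
  have hint' : IntegrableOn r'.integrand r.domain := by
    rw [← hdd]; exact r'.integrableOn
  let s : IntegralRep 3 :=
    { domain := r.domain
      integrand := r.integrand + r'.integrand
      isSemialgebraic_domain := r.isSemialgebraic_domain
      isSemialgebraicFunOn_integrand :=
        IsSemialgebraicFunOn.add_holds r.isSemialgebraicFunOn_integrand hsa'
      integrableOn := r.integrableOn.add hint' }
  -- both pinned integrands are positive on the cube, hence so is `f + f'`
  have hpos : ∀ t ∈ r.domain, 0 < (r.integrand + r'.integrand) t := by
    intro t ht
    have htc : ∀ j, t j ∈ Set.Ioo (0:ℝ) 1 := by rw [hrd] at ht; exact ht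
    have ht' : t ∈ r'.domain := by rw [hdd]; exact ht
    rw [Pi.add_apply, hri ht, hr'i ht']
    exact add_pos (dasIntegrand_pos t htc) (dasPiIntegrand_pos t htc)
  -- so the value of `s` is positive: the cube has positive measure
  have hmeas : MeasurableSet r.domain := IntegralRep.measurableSet_domain_holds r
  have hs_pos : 0 < s.value := by
    change 0 < ∫ t in r.domain, (r.integrand + r'.integrand) t
    have h0 : 0 ≤ᵐ[volume.restrict r.domain] (r.integrand + r'.integrand) := by
      filter_upwards [ae_restrict_mem hmeas] with t ht using (hpos t ht).le
    rw [setIntegral_pos_iff_support_of_nonneg_ae h0 (r.integrableOn.add hint')]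
    have hsub : r.domain ⊆ Function.support (r.integrand + r'.integrand) ∩ r.domain :=
      fun t ht => ⟨(hpos t ht).ne', ht⟩
    calc (0 : ENNReal) < volume r.domain := by rw [hrd]; exact volume_dasCube_pos
      _ ≤ volume (Function.support (r.integrand + r'.integrand) ∩ r.domain) := measure_mono hsub
  -- `[s] ≡ [r] + [r']` : one integrand-additivity move
  have hc : of s - of r - of r' ∈ relations :=
    integrandAddRel_subset_relations ⟨3, s, r, r', rfl, hdd, fun _ _ => rfl, rfl⟩
  -- the products `r × s ∼ r' × s` : ideal arithmetic modulo `relations`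
  have hE : Equivalent (r.prod s) (r'.prod s) := by
    unfold Equivalent
    rw [← of_mul_of, ← of_mul_of]
    have hsq' : of r * of r - of r' * of r' ∈ relations := by
      rw [of_mul_of, of_mul_of]; exact hsq
    have hcomm : of r * of r' - of r' * of r ∈ relations := mul_sub_mul_comm_mem_relations _ _
    have key : of r * of s - of r' * of s =
        (of r * (of s - of r - of r') - of r' * (of s - of r - of r')) +
          (of r * of r - of r' * of r') + (of r * of r' - of r' * of r) := by
      simp only [mul_sub]
      abel
    rw [key]
    exact relations.add_mem (relations.add_mem (relations.sub_mem
      (mul_mem_relations_left_holds _ _ hc) (mul_mem_relations_left_holds _ _ hc)) hsq') hcomm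
  refine ⟨3, 3, 3, r, r', s, r.prod s, r'.prod s, rfl, ?_, rfl, ?_, hs_pos.ne', hE, hne⟩
  · intro z _
    rw [IntegralRep.prod_integrand_eq]
    rfl
  · intro z _
    rw [IntegralRep.prod_integrand_eq]
    rfl

/-- **Composition of the line** (registered skeleton shape): the crux `Neg.CancellationGap` BY NAME from the two
stubs, via `cancellationGap_of_das`. Sorries live only in the stubs. [folklore] -/
theorem CancellationGap_of :
    Summit.KontsevichZagierPeriods.KontsevichZagierPeriods.Theses.Neg.CancellationGap :=
  cancellationGap_of_das stub_dasSquareAccessible stub_dasRootNotAccessible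

end Summit.KontsevichZagierPeriods.KontsevichZagierPeriods.Cruxes.CancellationGap.DasSquareRootSeam

end
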